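import Summits.KontsevichZagierPeriods.Zeta5Search.Certificates.VIML3Defs
import Summits.KontsevichZagierPeriods.Zeta5Search.Certificates.ModRedLK3All
import HarnessLib

/-!
# ζ(5) search — brown9 LEVEL 3: the input (L-K3) is cert-2's kernel theorem (cell `pub-zeta5`, certifier `cert-1`)

HONEST FRAMING: systematic search; recurrence certificates; no irrationality claim unless certified.

Bridge between the two certifier seats: cert-2's kernel replay of the lane's (L-K3) relation
(`VIMInner.ModRed.L_rel_K3_all`, `Certificates/ModRedLK3All.lean`: for `n ≥ 2` and EVERY rational `x`) is exactly the
input predicate `VIMInner.L3.LK3At n` of the level-3 replay (`VIML3Defs`): the two seats' triple sums `Lsum` agree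
definitionally and the coefficient data `etaL0..3` (dense `Poly2`) evaluate to `thQ0..3`. Hence `LK3At_holds`.
No named facts.
-/

namespace Summit.KontsevichZagierPeriods.Zeta5Search.Certificates

namespace VIMInner.L3

open Summit.KontsevichZagierPeriods.Zeta5Search.PolyReflect

/-- The two seats' triple sums coincide. -/
theorem ModRed_Lsum_eq (n : ℕ) (x : ℚ) : ModRed.Lsum n x = Lsum n x := rfl

/-- `etaL0` (cert-2) evaluates to `thQ0` (cert-1). -/
theorem etaL0_thQ0 (w x : ℚ) : ev2 ModRed.etaL0 w x = thQ0 w x := by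
  simp [ModRed.etaL0, ev2, ev1, thQ0]; ring

/-- `etaL1` evaluates to `thQ1`. -/
theorem etaL1_thQ1 (w x : ℚ) : ev2 ModRed.etaL1 w x = thQ1 w x := by
  simp [ModRed.etaL1, ev2, ev1, thQ1]; ring

/-- `etaL2` evaluates to `thQ2`. -/
theorem etaL2_thQ2 (w x : ℚ) : ev2 ModRed.etaL2 w x = thQ2 w x := by
  simp [ModRed.etaL2, ev2, ev1, thQ2]; ring

/-- `etaL3` evaluates to `thQ3`. -/
theorem etaL3_thQ3 (w x : ℚ) : ev2 ModRed.etaL3 w x = thQ3 w x := by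
  simp [ModRed.etaL3, ev2, ev1, thQ3]; ring

/-- **(L-K3) holds** at every level `n ≥ 2` (cert-2's `ModRed.L_rel_K3_all`), in the form used by the level-3 replay. -/
theorem LK3At_holds (n : ℕ) (hn : 2 ≤ n) : LK3At n := by
  intro x
  have h := ModRed.L_rel_K3_all n hn x
  rw [etaL0_thQ0, etaL1_thQ1, etaL2_thQ2, etaL3_thQ3] at h
  exact h

end VIMInner.L3

end Summit.KontsevichZagierPeriods.Zeta5Search.Certificates
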